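import Literature.MathematicalPhysics.QuantumFieldTheory.Balaban1983to89.B8Thm4AtLandau138
import Literature.MathematicalPhysics.QuantumFieldTheory.Balaban1983to89.B8Eq188Proof

/-!
# `Balaban1983to89.B8Prop5KLevelLetters` — [Balaban1985RegularSpaces] PROPOSITION 5 (p. 94) AT `k` LEVELS FROM THE LETTERS OF [4]:
# the provider's side of the sockets `hP5base`/`hP5 m` of the Theorem-4 knit at `Lan := IsLandau138W` — v1: Sect. D's D*-identity
# (1.86)–(1.88) in the currency of the Landau predicate of record, the multiplier-form Landau condition of the gauge-fixed field
# from it, and (1.108) in the sockets' currency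

statement-level skeleton of published theorems with citation tags; proofs where landed; nothing here is a claim about the
Yang–Mills mass gap

T. Bałaban, *Spaces of regular gauge field configurations on a lattice and gauge fixing conditions*, Commun. Math. Phys. **99**
(1985) 75–102 `[Balaban1985RegularSpaces]` ("B8"; printed page = PDF page + 74), Sect. D pp. 91–94 ((1.86)–(1.100)), Prop. 5 p. 94
((1.107)–(1.109)), (1.38) p. 82; [3] = [Balaban1985Averaging], [4] = [Balaban1985BackgroundPropagators].  PDF held:
`paper:balaban1985-cmp99-regular-spaces-gauge-fixing` (pp. 91–94 read on the text layer by this seat).  STATUS: published, refereed.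

CITATION HEADER (lean-in-tree rule).  Cell `pub-ymgap` (YM Track A, DAG node N05 = [B8], HUMAN RULING D-0062), seat
`pub-ymgap-dag-n04-b` gen 2; piece №41-a of dag-lead's REBALANCE №41 = the N05 knit owner's CUT-3 «hP5 at k levels from letters»
(`pub-ymgap-dag-n05-a` g4 [DAGN05A-G4-CUT-3] + [WORD-41]; piece №41-b = the k-level Banach λ-space + the (1.100) fixed point,
seat `pub-ymgap-dag-n19-b` g2).  Kind «kernel-checked proof», theorems only: no `def`, no `… : Prop` fact, no existing module modified.
REUSED BY NAME: p05/r05's `B8Eq188Proof.eq188` ((1.88) exact with `frakF3` explicit), `B8Eq188Proof.logCfg`, `B8Eq182Proof.gAd`,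
`B8Eq184Proof.{gaugeExp, cfgExp}`, n05-a's `B8Eq138LandauZd.{covDivB, covLap, QT, logCfg, IsLandau138, IsLandau138W}`,
`B8Ineq132.{covDeriv, covDerivFwd}`, `B7Eq170Flat.cj`, `B7Eq78Linearization.conjR`.

## THE PRINTED TEXT

p. 91 [PDF 17]: «(D*(1/iη) log U₁^{u′⁻¹})(x) = e^{−i ad_{λ(x)}}(D*A)(x) + g(i ad_{λ(x)})(D*Dλ)(x) + 𝔉₃(λ(x), Dλ, A), (1.88) … Equations
(1.79), (1.80) can be written as R[e^{−i ad_λ}D*A + g(i ad_λ)Δλ + 𝔉₃(λ, Dλ, A)] = 0, Q′(u₁, λ) = 0. (1.90)»; p. 94 [PDF 20]: «The solution λ of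
Eq. (1.100) determines the configuration u′ = exp[i(λ − H′D′(u₁, λ))] we are looking for. … Proposition 5. … there exists a configuration
u′ = e^{iλ} satisfying the equations R(U₀)D*(1/iη) log U₁^{u′⁻¹} = 0, R̄ʲ(u′u₁) = 1 on Λ_j, j = 0, 1, …, k (1.107) and the bounds |λ|,
|D^η_{U₀}λ|_(−1) < 8B′₀B₁(α₀ + α₁). (1.108)».

## WHAT IS CERTIFIED HERE (kernel; axioms `propext` / `Classical.choice` / `Quot.sound`)

* §1 `logCfg_mgauge_inv_eq` — the exponent field of the gauge-fixed configuration in the Landau predicate's currency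
  (`B8Eq138LandauZd.logCfg η (U₁^{v⁻¹})`, `v = e^{iλ}` acting by the moving frame (55), `U₁ = e^{iηA}`) IS the bond field `(1/iη) log U₁^{u′⁻¹}`
  of the (1.81)–(1.88) chain (`B8Eq188Proof.logCfg`), by `rfl`.  **`covDivB_logCfg_gaugeFixed`** — THE D*-IDENTITY (1.86)–(1.88) IN THE
  LANDAU-PREDICATE CURRENCY, exact, remainder EXPLICIT: at a site `x` with `|λ(x)| ≤ 1/12`, `η|(D_μλ)(x)|, η|(D*_μλ)(x)| ≤ 1/70`,
  `η|R(U₀(x, x − ηe_μ))A_μ(x − ηe_μ)| ≤ 1/12` (all `μ`):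
  `D^{η*}_{U₀}[(1/iη) log U₁^{v⁻¹}](x) = (D^{η*}_{U₀}A)(x) + (Δ^η_{U₀}λ)(x) + 𝔑(λ)(x)`,
  `𝔑(λ)(x) = [e^{−i ad_{λ(x)}} − 1](D^{η*}_{U₀}A)(x) + [g(i ad_{λ(x)}) − 1](Δ^η_{U₀}λ)(x) + Σ_μ 𝔉₃,μ(x)` — the «Y − Δλ − Nλ» shape that
  `B8Eq195Linear.fixedPoint_iff_constraint_and_multiplier` consumes, WITH A SIGN NOTE: in the tree's conventions `(1/iη) log (U₁^{u′⁻¹})_b =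
  A_b + (Dλ)(b) + …` (abelian check `e^{−iλ(x)}e^{iηA}e^{iλ(x+ηe)} = e^{iη(A + Dλ)}`), so the (positive) Laplacian `Δ^η_{U₀} = D^{η*}D^η`
  (`covLap`) enters with a PLUS; the abstract `Δ` of that skeleton is to be instantiated as `−covLap` (or `N λ := −(2Δλ + 𝔑λ)`).
  **`isLandau138W_gaugeFixed_of_multiplier`** — the route step (ii) of the cut MODULO THE FIXED POINT: a multiplier `μ` with
  `Δ^η_{U₀}↾Ω₀[D^{η*}A + Δλ + 𝔑(λ)] = Q′(U₀)ᵀμ` on `Ω₀` (what the fixed point of (1.100) delivers through the skeleton) plus the smallness at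
  every site of `Ω₀` ⇒ the gauge-fixed field satisfies the LANDAU CONDITION OF RECORD, `IsLandau138W L m η Ω₀ Λs U₀ (U₁^{v⁻¹})`.
* §2 `bound108_of_weighted` / `weighted_of_bound108` — step (iii) of the cut: (1.108) in the SOCKETS' currency «`‖λ(b₋)‖ ≤ α₄ ∧
  (Lʲη)·‖(D^η_{U₀,κ}λ)(b₋)‖ ≤ α₄`» ⇔ the sup-weight currency of the λ-space (1.102)/(1.119) «`‖λ(x)‖ ≤ α₄`, `Lʲ·‖R(U₀(b))λ(b₊) − λ(b₋)‖ ≤ α₄`»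
  (`(Lʲη)(D^η_{U₀,κ}λ)(x) = Lʲ(R(U₀(x, x+ηe_κ))λ(x+ηe_κ) − λ(x))` by (1.1)).

## v1.1 (APPEND-ONLY, same seat): §3 ORDER BOOKKEEPING for «u = u′u₁»

`mul_conj_eq` (`u₁·(u₁⁻¹u′u₁) = u′·u₁`), `restr129_mul_conj_iff` ((1.29) for the driver's `u₁·v`, `v := u₁⁻¹u′u₁`, IS (1.29) for the
(1.78)-chain's `u′·u₁`), `conj_gaugeExp_eq` (`u₁⁻¹e^{iλ}u₁ = e^{i·Ad(u₁⁻¹)λ}` pointwise), `norm_conj_param` (`‖Ad(u₁⁻¹)λ‖ = ‖λ‖`, unitary-type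
`u₁`), `covDerivFwd_conj_param` (`D^η_{U₀,κ}(Ad(u₁⁻¹)λ) = Ad(u₁⁻¹)·D^η_{U₀^{u₁},κ}λ`, exact), `weight_norm_covDerivFwd_conj_param`,
`norm_covDerivFwd_gaugeAct_sub_le` (`‖D^η_{U₀^{u₁},κ}λ − D^η_{U₀,κ}λ‖ ≤ η⁻¹·2ε·‖λ(b₊)‖` when the twisted derivative
`u₁(x)U₀(b)u₁(b₊)⁻¹U₀(b)⁻¹` is within `ε` of `1` — the (1.74)-type smallness): what the reconciliation `v := u₁⁻¹u′u₁` of the two tree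
typings of print's composite costs on (1.108), for whichever ruling the cut's owner gives.

## WHAT IS NOT (YET) HERE — the remaining steps of the cut, for v2 / the partner piece

(i) The fixed point of (1.100) in the k-level λ-space (1.102) (piece №41-b, `pub-ymgap-dag-n19-b`); (ii′) the passage from «Q′λ̃ = 0» +
(1.114) to the (1.29)-clause `Restr129 L (m+1) (Λs (m+1)) U₀ (u₁·v)` of the socket (r05's `B8Eq178Averages.restr129_mul_iff_cond179`, n05-b's
`B8Eq1117KLevel`/`B8Claim97KLevel`) — LOCATED SEAM: r05's (1.78)/(1.79)/Sect. E files type print's composite «u = u′u₁» as the POINTWISE product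
`u′ * u₁`, while the (1.80)–(1.88) chain (`U₁^{u′⁻¹}`) and the Theorem-4 driver (`u₁ * v`, `mgauge U₀ v⁻¹ U₁`) compose the other way
(`B7Eq106Concrete.mgauge_mgauge`: `(W^{b})^{a} = W^{ab}`); the provider must reconcile the two (conjugation `v := u₁⁻¹u′u₁`, `λ ↦ Ad(u₁⁻¹)λ`,
at the price of comparing `D^η_{U₀}` with `D^η_{U₀^{u₁}}`), recorded on the pub-ymgap bus for the owner — §3 (v1.1) supplies the algebra of the conjugation; (iii′) the bounds (1.97)–(1.99) on `𝔑`
(its three terms are `O(|λ|·|D*A|)`, `O(|λ|·|Δλ|)`, `O(|Dλ|(|Dλ| + |A|))` by `norm_conjR_sub_self`-type, `B8Ineq1109Local.norm_gAd_sub_self_le`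
and `B8Eq188Proof.norm_frakF3_le`); (iv) the assembly of the socket `hP5 m`.  HONEST SCOPE: count-neutral; Proposition 5 is NOT proved
here; nothing continuum / mass-gap / Clay.
-/

noncomputable section

open NormedSpace
open Complex (I I_ne_zero)

namespace Literature.MathematicalPhysics.QuantumFieldTheory.Balaban1983to89.B8Prop5KLevelLetters

open MatrixLog B7Prop1Explicit B7Prop2Explicit B7Eq92Concrete
open B7Eq78Linearization (conjR)
open B8Ineq132 (covDerivFwd covDeriv)
open B8Eq182Proof (gAd)
open B8Eq184Proof (gaugeExp cfgExp)
open B8Eq188Proof (frakF3)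
open B8Eq138LandauZd (covDivB covLap QT logCfg IsLandau138 IsLandau138W)

-- `Site` alone could resolve to the torus sites of `Setup.lean`; re-export the `ℤ^d` sites of `B7Prop1Explicit`.
export B7Prop1Explicit (Site)

variable {d : ℕ} {𝔸 : Type*} [NormedRing 𝔸] [NormedAlgebra ℂ 𝔸] [NormOneClass 𝔸] [CompleteSpace 𝔸]

/-! ## §1 The D*-identity (1.86)–(1.88) in the currency of the Landau predicate of record:
`D^{η*}_{U₀}((1/iη) log U₁^{v⁻¹}) = D^{η*}_{U₀}A + Δ^η_{U₀}λ + 𝔑(λ)` with the remainder EXPLICIT -/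

section DStarIdentity

omit [NormOneClass 𝔸] in
/-- The exponent field of the gauge-fixed configuration `U₁^{v⁻¹}`, `v = e^{iλ}`, `U₁ = e^{iηA}`, in the currency of the Landau
predicate of record (`B8Eq138LandauZd.logCfg`) IS the bond field `(1/iη) log U₁^{u′⁻¹}` of the (1.81)–(1.88) chain
(`B8Eq188Proof.logCfg`). [cite: Balaban1985RegularSpaces, (1.84) p.90, (1.36) p.82] -/
theorem logCfg_mgauge_inv_eq (η : ℝ) (U₀ : Site d → Fin d → 𝔸ˣ) (lam : Site d → 𝔸) (A : Site d → Fin d → 𝔸) :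
    logCfg η (mgauge U₀ (gaugeExp lam)⁻¹ (cfgExp η A)) = B8Eq188Proof.logCfg η U₀ lam A := rfl

/-- **THE D*-IDENTITY OF SECT. D IN THE LANDAU-PREDICATE CURRENCY** ((1.86)–(1.88) p. 91, exact, remainder explicit): at a site `x`
where `|λ(x)| ≤ 1/12`, `η|(D_μλ)(x)|, η|(D*_μλ)(x)| ≤ 1/70` and `η|R(U₀(x, x − ηe_μ))A_μ(x − ηe_μ)| ≤ 1/12` for every direction,
`D^{η*}_{U₀}[(1/iη) log U₁^{v⁻¹}](x) = (D^{η*}_{U₀}A)(x) + (Δ^η_{U₀}λ)(x) + 𝔑(λ)(x)` with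
`𝔑(λ)(x) = [e^{−i ad_{λ(x)}} − 1](D^{η*}_{U₀}A)(x) + [g(i ad_{λ(x)}) − 1](Δ^η_{U₀}λ)(x) + 𝔉₃(x)` (`B8Eq188Proof.eq188` rearranged;
`D^{η*}_{U₀}` on bond fields = `covDivB`, `Δ^η_{U₀} = D^{η*}D^η` = `covLap` of `B8Eq138LandauZd`).  SIGN NOTE for the fixed-point providers:
in the tree's conventions `(1/iη) log (U₁^{u′⁻¹})_b = A_b + (Dλ)(b) + …` (abelian check `e^{−iλ(x)}e^{iηA}e^{iλ(x+ηe)} = e^{iη(A + Dλ)}`), so the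
Laplacian enters with a PLUS; the template `Y − Δλ − Nλ` of `B8Eq195Linear.fixedPoint_iff_constraint_and_multiplier` is met with
`Y := D^{η*}A`, `N λ := −(2Δλ + 𝔑λ)` or, better, by instantiating its abstract `Δ` as `−covLap`.
[cite: Balaban1985RegularSpaces, (1.86)–(1.88) p.91, (1.38) p.82, (1.95) p.92] -/
theorem covDivB_logCfg_gaugeFixed {η : ℝ} (hη : 0 < η) (U₀ : Site d → Fin d → 𝔸ˣ) {lam : Site d → 𝔸} (A : Site d → Fin d → 𝔸)
    {x : Site d} (hl : ‖lam x‖ ≤ 1 / 12) (hD : ∀ μ, η * ‖covDerivFwd η U₀ μ lam x‖ ≤ 1 / 70)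
    (ha : ∀ μ, η * ‖covDeriv η U₀ μ lam x‖ ≤ 1 / 70)
    (hY : ∀ μ, η * ‖conjR (U₀ (x - e μ) μ)⁻¹ (A (x - e μ) μ)‖ ≤ 1 / 12) :
    covDivB η U₀ (logCfg η (mgauge U₀ (gaugeExp lam)⁻¹ (cfgExp η A))) x =
      covDivB η U₀ A x + covLap η U₀ lam x +
        ((conjR (gaugeExp lam x)⁻¹ (covDivB η U₀ A x) - covDivB η U₀ A x) +
          (gAd (covLap η U₀ lam x) (lam x) - covLap η U₀ lam x) + ∑ μ, frakF3 η U₀ lam A x μ) := by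
  rw [logCfg_mgauge_inv_eq]
  have h := B8Eq188Proof.eq188 hη U₀ A hl hD ha hY
  have hL : covLap η U₀ lam x = ∑ μ, covDeriv η U₀ μ (covDerivFwd η U₀ μ lam) x := rfl
  have hB : covDivB η U₀ A x = ∑ μ, covDeriv η U₀ μ (fun y => A y μ) x := rfl
  show (∑ μ, covDeriv η U₀ μ (fun y => B8Eq188Proof.logCfg η U₀ lam A y μ) x) = _
  rw [h, hL, hB]
  abel

/-- **The multiplier form transported**: if the linear-algebra skeleton (`B8Eq195Linear`) or any fixed-point argument delivers a
multiplier `μ` with `Δ^η_{U₀}↾Ω₀[D^{η*}_{U₀}A + Δ^η_{U₀}λ + 𝔑(λ)] = Q′(U₀)ᵀμ` on `Ω₀` (the D*-identity's right-hand side), and the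
smallness hypotheses of `covDivB_logCfg_gaugeFixed` hold at every site of `Ω₀`, then the gauge-fixed field `U₁^{v⁻¹}` satisfies the
LANDAU CONDITION OF RECORD (1.38) at `m` levels: `IsLandau138W L m η Ω₀ Λs U₀ (U₁^{v⁻¹})`.  (The route step (ii) of the Prop.-5 cut,
modulo the fixed point.) [cite: Balaban1985RegularSpaces, (1.38) p.82, (1.90)–(1.95) pp.91–92] -/
theorem isLandau138W_gaugeFixed_of_multiplier {η : ℝ} (hη : 0 < η) (L m : ℕ) (Ω₀ : Set (Site d)) (Λs : ℕ → Set (Site d))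
    (U₀ : Site d → Fin d → 𝔸ˣ) {lam : Site d → 𝔸} (A : Site d → Fin d → 𝔸)
    (hl : ∀ x ∈ Ω₀, ‖lam x‖ ≤ 1 / 12) (hD : ∀ x ∈ Ω₀, ∀ μ, η * ‖covDerivFwd η U₀ μ lam x‖ ≤ 1 / 70)
    (ha : ∀ x ∈ Ω₀, ∀ μ, η * ‖covDeriv η U₀ μ lam x‖ ≤ 1 / 70)
    (hY : ∀ x ∈ Ω₀, ∀ μ, η * ‖conjR (U₀ (x - e μ) μ)⁻¹ (A (x - e μ) μ)‖ ≤ 1 / 12)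
    (hmult : ∃ μ : ℕ → Site d → 𝔸, ∀ x ∈ Ω₀,
      covLap η U₀ (Ω₀.indicator fun y => covDivB η U₀ A y + covLap η U₀ lam y +
        ((conjR (gaugeExp lam y)⁻¹ (covDivB η U₀ A y) - covDivB η U₀ A y) +
          (gAd (covLap η U₀ lam y) (lam y) - covLap η U₀ lam y) + ∑ μ, frakF3 η U₀ lam A y μ)) x = QT L m Λs U₀ μ x) :
    IsLandau138W L m η Ω₀ Λs U₀ (mgauge U₀ (gaugeExp lam)⁻¹ (cfgExp η A)) := by
  obtain ⟨μ, hμ⟩ := hmult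
  refine ⟨μ, fun x hx => ?_⟩
  have hind : Ω₀.indicator (covDivB η U₀ (logCfg η (mgauge U₀ (gaugeExp lam)⁻¹ (cfgExp η A)))) =
      Ω₀.indicator fun y => covDivB η U₀ A y + covLap η U₀ lam y +
        ((conjR (gaugeExp lam y)⁻¹ (covDivB η U₀ A y) - covDivB η U₀ A y) +
          (gAd (covLap η U₀ lam y) (lam y) - covLap η U₀ lam y) + ∑ μ, frakF3 η U₀ lam A y μ) := by
    refine Set.indicator_congr fun y hy => ?_
    exact covDivB_logCfg_gaugeFixed hη U₀ A (hl y hy) (hD y hy) (ha y hy) (hY y hy)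
  rw [hind]
  exact hμ x hx

end DStarIdentity

/-! ## §2 Step (iii): (1.108) in the socket's currency from sup-weight bounds on `λ` -/

section Bounds108

omit [NormOneClass 𝔸] [CompleteSpace 𝔸] in
/-- **(1.108) in the currency of the Theorem-4 sockets**: the k-level λ-space bound «|λ| ≤ α₄, |D^η_{U₀}λ|_(−1) ≤ α₄» read as
«`‖λ(x)‖ ≤ α₄` and `Lʲ·‖R(U₀(b))λ(b₊) − λ(b₋)‖ ≤ α₄` on the level-`j` bonds» (the (1.119)/(1.102) sup-weights of the n05-b lineage,
`B7Eq170Flat.cj`) gives the socket's pair `‖λ(b₋)‖ ≤ α₄ ∧ (Lʲη)·‖(D^η_{U₀,κ}λ)(b₋)‖ ≤ α₄` — `(Lʲη)(D^η_{U₀,κ}λ)(x) = Lʲ(R(U₀(x, x + ηe_κ))λ(x + ηe_κ) − λ(x))`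
by (1.1), `η > 0`. [cite: Balaban1985RegularSpaces, (1.108) p.94, (1.1) p.76, (1.102) p.93] -/
theorem bound108_of_weighted {η : ℝ} (hη : 0 < η) (L j : ℕ) (U₀ : Site d → Fin d → 𝔸ˣ) (lam : Site d → 𝔸) {α₄ : ℝ}
    {x : Site d} {κ : Fin d} (h0 : ‖lam x‖ ≤ α₄)
    (h1 : (L : ℝ) ^ j * ‖B7Eq170Flat.cj (U₀ x κ) (lam (x + e κ)) - lam x‖ ≤ α₄) :
    ‖lam x‖ ≤ α₄ ∧ ((L : ℝ) ^ j * η) * ‖covDerivFwd η U₀ κ lam x‖ ≤ α₄ := by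
  refine ⟨h0, ?_⟩
  have hcj : B7Eq170Flat.cj (U₀ x κ) (lam (x + e κ)) = conjR (U₀ x κ) (lam (x + e κ)) := rfl
  unfold covDerivFwd
  rw [norm_smul, norm_inv, Real.norm_eq_abs, abs_of_pos hη, ← hcj]
  have e1 : (L : ℝ) ^ j * η * (η⁻¹ * ‖B7Eq170Flat.cj (U₀ x κ) (lam (x + e κ)) - lam x‖) =
      (L : ℝ) ^ j * ‖B7Eq170Flat.cj (U₀ x κ) (lam (x + e κ)) - lam x‖ := by
    field_simp
  rw [e1]
  exact h1

omit [NormOneClass 𝔸] [CompleteSpace 𝔸] in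
/-- The converse reading: the socket's `(Lʲη)·‖(D^η_{U₀,κ}λ)(x)‖ ≤ α₄` IS the sup-weight bound `Lʲ·‖R(U₀(b))λ(b₊) − λ(b₋)‖ ≤ α₄`
(`η > 0`). [cite: Balaban1985RegularSpaces, (1.108) p.94, (1.1) p.76] -/
theorem weighted_of_bound108 {η : ℝ} (hη : 0 < η) (L j : ℕ) (U₀ : Site d → Fin d → 𝔸ˣ) (lam : Site d → 𝔸) {α₄ : ℝ}
    {x : Site d} {κ : Fin d} (h1 : ((L : ℝ) ^ j * η) * ‖covDerivFwd η U₀ κ lam x‖ ≤ α₄) :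
    (L : ℝ) ^ j * ‖B7Eq170Flat.cj (U₀ x κ) (lam (x + e κ)) - lam x‖ ≤ α₄ := by
  have hcj : B7Eq170Flat.cj (U₀ x κ) (lam (x + e κ)) = conjR (U₀ x κ) (lam (x + e κ)) := rfl
  unfold covDerivFwd at h1
  rw [norm_smul, norm_inv, Real.norm_eq_abs, abs_of_pos hη, ← hcj] at h1
  have e1 : (L : ℝ) ^ j * η * (η⁻¹ * ‖B7Eq170Flat.cj (U₀ x κ) (lam (x + e κ)) - lam x‖) =
      (L : ℝ) ^ j * ‖B7Eq170Flat.cj (U₀ x κ) (lam (x + e κ)) - lam x‖ := by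
    field_simp
  rwa [e1] at h1

end Bounds108

#print axioms covDivB_logCfg_gaugeFixed
#print axioms isLandau138W_gaugeFixed_of_multiplier

/-! ## §3 (v1.1) ORDER BOOKKEEPING for the composite gauge transformation «u = u′u₁» (p. 94): the two typings in the tree
(`u′ * u₁` in the (1.78)/(1.79)/Sect. E chain vs `u₁ * v` in the (1.80)–(1.88) chain and the Theorem-4 driver) are reconciled by the
conjugate `v := u₁⁻¹u′u₁ = e^{i·Ad(u₁⁻¹)λ}`; what it costs on (1.108) -/

section Order

/-- The conjugate gauge transformation `v := u₁⁻¹·u′·u₁` turns the driver's composite `u₁·v` into the (1.78)-chain's `u′·u₁`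
(pointwise group algebra). [cite: Balaban1985RegularSpaces, p.94 («u = u′u₁»), (1.78) p.90] -/
theorem mul_conj_eq {G : Type*} [Group G] (u₁ u' : Site d → G) : u₁ * (u₁⁻¹ * u' * u₁) = u' * u₁ := by
  funext x
  simp only [Pi.mul_apply, Pi.inv_apply]
  group

omit [NormOneClass 𝔸] in
/-- Hence (1.29) for the driver's composite `u₁·v`, `v = u₁⁻¹u′u₁`, IS (1.29) for the (1.78)-chain's `u′·u₁`
(`B8Eq178Averages.restr129_mul_iff_cond179` then applies verbatim). [cite: Balaban1985RegularSpaces, (1.29) p.81, (1.78) p.90, (1.107) p.94] -/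
theorem restr129_mul_conj_iff (L k : ℕ) (Λ : ℕ → Set (Site d)) (U₀ : Site d → Fin d → 𝔸ˣ) (u₁ u' : Site d → 𝔸ˣ) :
    B8Eq119TwistedAxial.Restr129 L k Λ U₀ (u₁ * (u₁⁻¹ * u' * u₁)) ↔ B8Eq119TwistedAxial.Restr129 L k Λ U₀ (u' * u₁) := by
  rw [mul_conj_eq]

omit [NormOneClass 𝔸] in
/-- The conjugate of `u′ = e^{iλ}` is again an exponential: `u₁(x)⁻¹ e^{iλ(x)} u₁(x) = e^{i·Ad(u₁(x)⁻¹)λ(x)}` — the socket's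
`gaugeExp` reading of `v` with the parameter `λ_v := Ad(u₁⁻¹)λ` ([3] (57): `R` commutes with `exp`).
[cite: Balaban1985RegularSpaces, (1.107) p.94; Balaban1985Averaging, (57) p.27] -/
theorem conj_gaugeExp_eq (u₁ : Site d → 𝔸ˣ) (lam : Site d → 𝔸) (x : Site d) :
    (u₁⁻¹ * gaugeExp lam * u₁) x = gaugeExp (fun y => conjR (u₁ y)⁻¹ (lam y)) x := by
  show (u₁ x)⁻¹ * gaugeExp lam x * u₁ x = gaugeExp (fun y => conjR (u₁ y)⁻¹ (lam y)) x
  rw [gaugeExp, gaugeExp, B7Eq78Linearization.conjR_apply, inv_inv]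
  have h := expUnit_conj (u₁ x)⁻¹ (I • lam x)
  rw [inv_inv] at h
  rw [Rc_apply, inv_inv] at h
  rw [← h, ← smul_mul_assoc, ← mul_smul_comm]

omit [NormedAlgebra ℂ 𝔸] [CompleteSpace 𝔸] in
/-- `‖Ad(u₁⁻¹)λ‖ = ‖λ‖` for unitary-type `u₁` (`{|u| ≤ 1, |u⁻¹| ≤ 1}`): the first member of (1.108) is unchanged by the conjugation.
[cite: Balaban1985RegularSpaces, (1.108) p.94] -/
theorem norm_conj_param {u₁ : Site d → 𝔸ˣ} (hu : ∀ x, u₁ x ∈ U1 𝔸) (lam : Site d → 𝔸) (x : Site d) :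
    ‖conjR (u₁ x)⁻¹ (lam x)‖ = ‖lam x‖ :=
  B8Ineq132.norm_conjR ((U1 𝔸).inv_mem (hu x)) _

omit [NormOneClass 𝔸] [CompleteSpace 𝔸] in
/-- **The covariant derivative of the conjugated parameter is the conjugate of the covariant derivative AT THE GAUGE-TRANSFORMED
BACKGROUND**: `D^η_{U₀,κ}(Ad(u₁⁻¹)λ)(x) = Ad(u₁(x)⁻¹)·(D^η_{U₀^{u₁},κ}λ)(x)` with `U₀^{u₁} = gaugeAct u₁ U₀` (exact algebra, (1.1)/(1.11)).
This is where the order bookkeeping costs: the second member of (1.108) for `λ_v = Ad(u₁⁻¹)λ` is the one of `λ` read at `U₀^{u₁}`, not at `U₀`.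
[cite: Balaban1985RegularSpaces, (1.1) p.76, (1.11) p.77, (1.108) p.94] -/
theorem covDerivFwd_conj_param (η : ℝ) (U₀ : Site d → Fin d → 𝔸ˣ) (u₁ : Site d → 𝔸ˣ) (lam : Site d → 𝔸) (κ : Fin d) (x : Site d) :
    covDerivFwd η U₀ κ (fun y => conjR (u₁ y)⁻¹ (lam y)) x =
      conjR (u₁ x)⁻¹ (covDerivFwd η (gaugeAct u₁ U₀) κ lam x) := by
  unfold covDerivFwd
  rw [B7Eq78Linearization.conjR_smul_real, B7Eq78Linearization.conjR_sub, B8Ineq132.conjR_conjR, B8Ineq132.conjR_conjR]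
  congr 2
  simp only [gaugeAct]
  congr 1
  group

omit [CompleteSpace 𝔸] in
/-- Consequently, for unitary-type `u₁` the socket's second (1.108) member for `λ_v` equals the one for `λ` at the transformed
background: `(Lʲη)‖(D^η_{U₀,κ}λ_v)(x)‖ = (Lʲη)‖(D^η_{U₀^{u₁},κ}λ)(x)‖`. [cite: Balaban1985RegularSpaces, (1.108) p.94, (1.11) p.77] -/
theorem weight_norm_covDerivFwd_conj_param (η : ℝ) (L j : ℕ) (U₀ : Site d → Fin d → 𝔸ˣ) {u₁ : Site d → 𝔸ˣ}
    (hu : ∀ x, u₁ x ∈ U1 𝔸) (lam : Site d → 𝔸) (κ : Fin d) (x : Site d) :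
    ((L : ℝ) ^ j * η) * ‖covDerivFwd η U₀ κ (fun y => conjR (u₁ y)⁻¹ (lam y)) x‖ =
      ((L : ℝ) ^ j * η) * ‖covDerivFwd η (gaugeAct u₁ U₀) κ lam x‖ := by
  rw [covDerivFwd_conj_param, B8Ineq132.norm_conjR ((U1 𝔸).inv_mem (hu x))]

omit [CompleteSpace 𝔸] in
/-- **The price of the conjugation, quantified**: the covariant derivatives of `λ` at `U₀^{u₁}` and at `U₀` differ by the TWISTED
DERIVATIVE OF `u₁` acting on `λ(x + ηe_κ)`: `‖(D^η_{U₀^{u₁},κ}λ)(x) − (D^η_{U₀,κ}λ)(x)‖ ≤ η⁻¹·2ε·‖λ(x + ηe_κ)‖` whenever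
`‖u₁(x)·U₀(b)·u₁(x + ηe_κ)⁻¹·U₀(b)⁻¹ − 1‖ ≤ ε` (the (1.74)-type smallness of `u₁`'s twisted derivative; unitary-type data).
[cite: Balaban1985RegularSpaces, (1.74) p.89, (1.108) p.94, (1.1) p.76] -/
theorem norm_covDerivFwd_gaugeAct_sub_le {η : ℝ} (hη : 0 < η) (U₀ : Site d → Fin d → 𝔸ˣ) {u₁ : Site d → 𝔸ˣ}
    (hu : ∀ x, u₁ x ∈ U1 𝔸) (hU₀ : ∀ x κ, U₀ x κ ∈ U1 𝔸) (lam : Site d → 𝔸) (κ : Fin d) (x : Site d) {ε : ℝ}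
    (hε : ‖((u₁ x * U₀ x κ * (u₁ (x + e κ))⁻¹ * (U₀ x κ)⁻¹ : 𝔸ˣ) : 𝔸) - 1‖ ≤ ε) :
    ‖covDerivFwd η (gaugeAct u₁ U₀) κ lam x - covDerivFwd η U₀ κ lam x‖ ≤ η⁻¹ * (2 * ε * ‖lam (x + e κ)‖) := by
  have hw : u₁ x * U₀ x κ * (u₁ (x + e κ))⁻¹ * (U₀ x κ)⁻¹ ∈ U1 𝔸 :=
    (U1 𝔸).mul_mem ((U1 𝔸).mul_mem ((U1 𝔸).mul_mem (hu x) (hU₀ x κ)) ((U1 𝔸).inv_mem (hu _))) ((U1 𝔸).inv_mem (hU₀ x κ))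
  have hkey : conjR (gaugeAct u₁ U₀ x κ) (lam (x + e κ)) =
      conjR (u₁ x * U₀ x κ * (u₁ (x + e κ))⁻¹ * (U₀ x κ)⁻¹) (conjR (U₀ x κ) (lam (x + e κ))) := by
    rw [B8Ineq132.conjR_conjR]
    simp only [gaugeAct, inv_mul_cancel_right]
  unfold covDerivFwd
  rw [← smul_sub, norm_smul, norm_inv, Real.norm_eq_abs, abs_of_pos hη, sub_sub_sub_cancel_right, hkey]
  refine mul_le_mul_of_nonneg_left ?_ (by positivity)
  have h := B7Prop3GeneralLinearBound.norm_conjR_sub_self_le hw hε (conjR (U₀ x κ) (lam (x + e κ)))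
  rwa [B8Ineq132.norm_conjR (hU₀ x κ)] at h

end Order

/-! ## §4 (v1.2) ASSEMBLY: the Prop.-5 sockets `hP5 m` / `hP5base` of the Theorem-4 driver of record
(`B8Thm4SupportLocal.thm4_exists_all_levels_supp_landau138`) from a fixed point `λ` displayed in PLAIN currency -/

section Assembly

open B8Ineq132 (BondTouches)
open B8Eq140Level (SideTouches)
open B8Eq119TwistedAxial (Restr129)
open B8Thm4TruncationLocal (base_datum)

/-- In `d ≥ 2` a bond with an end-point in `S` is a side of a plaquette touching `S` («b ∈ Ω» ⊆ the `SideTouches` bonds).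
[cite: Balaban1985RegularSpaces, p.77 (convention before (1.5))] -/
private theorem sideTouches_of_bondTouches₂ (hd2 : 2 ≤ d) {S : Set (Site d)} {y : Site d} {τ : Fin d}
    (hb : BondTouches S y τ) : SideTouches S y τ := by
  haveI : Nontrivial (Fin d) := Fin.nontrivial_iff_two_le.mpr hd2
  obtain ⟨κ, hκ⟩ := exists_ne τ
  exact B8Eq140Level.sideTouches_of_bondTouches hκ hb

variable {𝔹 : Type*} [CStarAlgebra 𝔹] [Nontrivial 𝔹]

/-- **The Prop.-5 step in plain currency ⇒ the socket `hP5 m` of the Theorem-4 driver** (one level, any `m`).  Given the datum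
of level `m` — `U₁ = e^{iηA}` on the bonds of the plaquettes touching `Ω_j`, `A` Hermitian, `|A| ≤ c⋆(Lʲη)⁻¹` (1.36) — and a
FIXED POINT `λ` displayed in plain currency: `λ` Hermitian, `λ = 0` off `Ω₀` ((1.109)), the bounds (1.108) at the `m + 1` levels,
the multiplier form of the Landau equation `Δ↾Ω₀[D*A + Δλ + 𝔑(λ)] = Q′ᵀμ` on `Ω₀` (the right-hand side of the D*-identity
(1.86)–(1.88), `covDivB_logCfg_gaugeFixed`), and (1.29) at `m + 1` levels for the composite `u₁·e^{iλ}` — the gauge transformation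
`v := e^{iλ}` is unitary, `= 1` off `Ω₀`, reads `e^{iλ}` on every bond, obeys (1.108), and `U₁^{v⁻¹}` satisfies the LANDAU CONDITION
OF RECORD (1.38) at `m + 1` levels (`isLandau138W_gaugeFixed_of_multiplier`, transported from `e^{iηA}` to `U₁` by locality on the
bonds «b ∈ Ω₀», `B8Eq138LandauZd.isLandau138W_congr`); the smallness hypotheses of (1.86)–(1.88) at the sites of `Ω₀` are READ OFF
(1.108) at level `j = 0` (`α₄ ≤ 1/84`, the backward derivative one bond back by `B8Eq151V2Divergence.norm_covDeriv_eq`) and (1.36) at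
`j = 0` (`c⋆ ≤ 1/12`).  [cite: Balaban1985RegularSpaces, Prop. 5 pp.93–94, (1.107)–(1.110) p.94, (1.86)–(1.88) p.91, (1.38) p.82] -/
theorem hP5_step_of_HFP (hd2 : 2 ≤ d) {η : ℝ} (hη : 0 < η) (L m : ℕ) {U₀ : Site d → Fin d → 𝔹ˣ}
    (hU₀ : ∀ x κ, U₀ x κ ∈ unitaryUnits 𝔹) {cstar α₄ : ℝ} (hs₁ : α₄ ≤ 1 / 84) (hcs : cstar ≤ 1 / 12)
    (Ω : ℕ → Set (Site d)) (Λs : ℕ → ℕ → Set (Site d)) (u₁ : Site d → 𝔹ˣ) (U₁ : Site d → Fin d → 𝔹ˣ) (A : Site d → Fin d → 𝔹)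
    (hdat : ∀ j, j ≤ m → ∀ b ∈ {b : Site d × Fin d | SideTouches (Ω j) b.1 b.2},
      U₁ b.1 b.2 = cfgExp η A b.1 b.2 ∧ IsSelfAdjoint (A b.1 b.2) ∧ ‖A b.1 b.2‖ ≤ cstar * ((L : ℝ) ^ j * η)⁻¹)
    (hFP : ∃ lam : Site d → 𝔹, (∀ x, IsSelfAdjoint (lam x)) ∧ (∀ x, x ∉ Ω 0 → lam x = 0) ∧
      (∀ j, j ≤ m + 1 → ∀ b ∈ {b : Site d × Fin d | SideTouches (Ω j) b.1 b.2},
        ‖lam b.1‖ ≤ α₄ ∧ ((L : ℝ) ^ j * η) * ‖covDerivFwd η U₀ b.2 lam b.1‖ ≤ α₄) ∧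
      (∃ μ : ℕ → Site d → 𝔹, ∀ x ∈ Ω 0,
        covLap η U₀ ((Ω 0).indicator fun y => covDivB η U₀ A y + covLap η U₀ lam y +
          ((conjR (gaugeExp lam y)⁻¹ (covDivB η U₀ A y) - covDivB η U₀ A y) +
            (gAd (covLap η U₀ lam y) (lam y) - covLap η U₀ lam y) + ∑ μ, frakF3 η U₀ lam A y μ)) x =
          QT L (m + 1) (Λs (m + 1)) U₀ μ x) ∧
      Restr129 L (m + 1) (Λs (m + 1)) U₀ (u₁ * gaugeExp lam)) :
    ∃ (v : Site d → 𝔹ˣ) (lam : Site d → 𝔹), (∀ x, v x ∈ unitaryUnits 𝔹) ∧ (∀ x, x ∉ Ω 0 → v x = 1) ∧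
      (∀ j, j ≤ m + 1 → ∀ b ∈ {b : Site d × Fin d | SideTouches (Ω j) b.1 b.2}, (v b.1 : 𝔹) = ((gaugeExp lam b.1 : 𝔹ˣ) : 𝔹) ∧
        (v (b.1 + e b.2) : 𝔹) = ((gaugeExp lam (b.1 + e b.2) : 𝔹ˣ) : 𝔹)) ∧
      (∀ j, j ≤ m + 1 → ∀ b ∈ {b : Site d × Fin d | SideTouches (Ω j) b.1 b.2},
        ‖lam b.1‖ ≤ α₄ ∧ ((L : ℝ) ^ j * η) * ‖covDerivFwd η U₀ b.2 lam b.1‖ ≤ α₄) ∧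
      IsLandau138W L (m + 1) η (Ω 0) (Λs (m + 1)) U₀ (mgauge U₀ v⁻¹ U₁) ∧ Restr129 L (m + 1) (Λs (m + 1)) U₀ (u₁ * v) := by
  obtain ⟨lam, hsa, hoff, h108, hmult, h129⟩ := hFP
  have hE0 : ∀ {y : Site d} {τ : Fin d}, BondTouches (Ω 0) y τ → (y, τ) ∈ {b : Site d × Fin d | SideTouches (Ω 0) b.1 b.2} :=
    fun hb => sideTouches_of_bondTouches₂ hd2 hb
  have hα12 : α₄ ≤ 1 / 12 := hs₁.trans (by norm_num)
  have hα70 : α₄ ≤ 1 / 70 := hs₁.trans (by norm_num)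
  have hd1 : 0 < d := by omega
  -- (1.108) at level `j = 0` on the bonds touching `Ω₀`
  have h0 : ∀ y τ, BondTouches (Ω 0) y τ → ‖lam y‖ ≤ α₄ ∧ η * ‖covDerivFwd η U₀ τ lam y‖ ≤ α₄ := fun y τ hb => by
    simpa only [pow_zero, one_mul] using h108 0 (Nat.zero_le _) (y, τ) (hE0 hb)
  have hl : ∀ x ∈ Ω 0, ‖lam x‖ ≤ 1 / 12 := fun x hx => (h0 x ⟨0, hd1⟩ (Or.inl hx)).1.trans hα12
  have hD : ∀ x ∈ Ω 0, ∀ μ, η * ‖covDerivFwd η U₀ μ lam x‖ ≤ 1 / 70 := fun x hx μ => (h0 x μ (Or.inl hx)).2.trans hα70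
  have hback : ∀ x ∈ Ω 0, ∀ μ : Fin d, BondTouches (Ω 0) (x - e μ) μ := fun x hx μ => Or.inr (by rwa [sub_add_cancel])
  have ha : ∀ x ∈ Ω 0, ∀ μ, η * ‖covDeriv η U₀ μ lam x‖ ≤ 1 / 70 := fun x hx μ => by
    rw [B8Eq151V2Divergence.norm_covDeriv_eq (unitaryUnits_le_U1 (hU₀ _ _)) lam]
    exact (h0 _ μ (hback x hx μ)).2.trans hα70
  have hY : ∀ x ∈ Ω 0, ∀ μ, η * ‖conjR (U₀ (x - e μ) μ)⁻¹ (A (x - e μ) μ)‖ ≤ 1 / 12 := fun x hx μ => by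
    obtain ⟨-, -, hA⟩ := hdat 0 (Nat.zero_le _) (x - e μ, μ) (hE0 (hback x hx μ))
    rw [B8Ineq132.norm_conjR ((U1 𝔹).inv_mem (unitaryUnits_le_U1 (hU₀ _ _)))]
    rw [pow_zero, one_mul] at hA
    calc η * ‖A (x - e μ) μ‖ ≤ η * (cstar * η⁻¹) := mul_le_mul_of_nonneg_left hA hη.le
      _ = cstar := by rw [mul_left_comm, mul_inv_cancel₀ hη.ne', mul_one]
      _ ≤ 1 / 12 := hcs
  have hLan : IsLandau138W L (m + 1) η (Ω 0) (Λs (m + 1)) U₀ (mgauge U₀ (gaugeExp lam)⁻¹ (cfgExp η A)) :=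
    isLandau138W_gaugeFixed_of_multiplier hη L (m + 1) (Ω 0) (Λs (m + 1)) U₀ A hl hD ha hY hmult
  have hcongr : ∀ (x : Site d) (μ : Fin d), BondTouches (Ω 0) x μ →
      mgauge U₀ (gaugeExp lam)⁻¹ U₁ x μ = mgauge U₀ (gaugeExp lam)⁻¹ (cfgExp η A) x μ := fun x μ hb => by
    rw [mgauge_apply, mgauge_apply, (hdat 0 (Nat.zero_le _) (x, μ) (hE0 hb)).1]
  refine ⟨gaugeExp lam, lam, fun x => ?_, fun x hx => ?_, fun j _ b _ => ⟨rfl, rfl⟩, h108,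
    (B8Eq138LandauZd.isLandau138W_congr η L U₀ hcongr).mpr hLan, h129⟩
  · exact mem_unitaryUnits.mpr (B8Ineq170.exp_I_smul_mem_unitary (hsa x))
  · exact Units.ext (by rw [gaugeExp, hoff x hx, smul_zero, val_expUnit, NormedSpace.exp_zero, Units.val_one])


/-- **The socket `hP5` of `B8Thm4SupportLocal.thm4_exists_all_levels_supp_landau138`, verbatim, from the fixed point in plain
currency at every level `1 ≤ m < k`.**  The hypothesis `HFP` is the Prop.-5 fixed point (1.106)/(1.107) — produced on the k-level
λ-space by the contraction (1.103)–(1.105) (`B8Prop5ContractionKLevel`, Hölder letters `G′, C, H′` of (1.99)–(1.101)) — handed over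
as: `λ` Hermitian and `= 0` off `Ω₀`, (1.108) at the `m + 1` levels, the multiplier form of `Δ↾Ω₀ D*[(1/iη) log U₁^{v⁻¹}] = Q′ᵀμ`
with the D*-identity's right-hand side, and (1.29) for `u₁·e^{iλ}` (Sect. E); it receives every premise the driver gives the socket.
[cite: Balaban1985RegularSpaces, Prop. 5 pp.93–94, (1.106)–(1.110) p.94, Theorem 4 p.82] -/
theorem hP5_of_HFP (hd2 : 2 ≤ d) {η : ℝ} (hη : 0 < η) (L k : ℕ) {U₀ U' : Site d → Fin d → 𝔹ˣ}
    (hU₀ : ∀ x κ, U₀ x κ ∈ unitaryUnits 𝔹) {cstar α₄ : ℝ} (hs₁ : α₄ ≤ 1 / 84) (hcs : cstar ≤ 1 / 12)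
    (Ω : ℕ → Set (Site d)) (Λs : ℕ → ℕ → Set (Site d))
    (HFP : ∀ m, 1 ≤ m → m < k → ∀ (u₁ : Site d → 𝔹ˣ) (U₁ : Site d → Fin d → 𝔹ˣ) (A : Site d → Fin d → 𝔹),
      (∀ x, u₁ x ∈ unitaryUnits 𝔹) → (∀ x, x ∉ Ω 0 → u₁ x = 1) → mgauge U₀ u₁ U₁ = U' → Restr129 L m (Λs m) U₀ u₁ →
      IsLandau138W L m η (Ω 0) (Λs m) U₀ U₁ →
      (∀ j, j ≤ m → ∀ b ∈ {b : Site d × Fin d | SideTouches (Ω j) b.1 b.2},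
        U₁ b.1 b.2 = cfgExp η A b.1 b.2 ∧ IsSelfAdjoint (A b.1 b.2) ∧ ‖A b.1 b.2‖ ≤ cstar * ((L : ℝ) ^ j * η)⁻¹) →
      ∃ lam : Site d → 𝔹, (∀ x, IsSelfAdjoint (lam x)) ∧ (∀ x, x ∉ Ω 0 → lam x = 0) ∧
        (∀ j, j ≤ m + 1 → ∀ b ∈ {b : Site d × Fin d | SideTouches (Ω j) b.1 b.2},
          ‖lam b.1‖ ≤ α₄ ∧ ((L : ℝ) ^ j * η) * ‖covDerivFwd η U₀ b.2 lam b.1‖ ≤ α₄) ∧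
        (∃ μ : ℕ → Site d → 𝔹, ∀ x ∈ Ω 0,
          covLap η U₀ ((Ω 0).indicator fun y => covDivB η U₀ A y + covLap η U₀ lam y +
            ((conjR (gaugeExp lam y)⁻¹ (covDivB η U₀ A y) - covDivB η U₀ A y) +
              (gAd (covLap η U₀ lam y) (lam y) - covLap η U₀ lam y) + ∑ μ, frakF3 η U₀ lam A y μ)) x =
            QT L (m + 1) (Λs (m + 1)) U₀ μ x) ∧
        Restr129 L (m + 1) (Λs (m + 1)) U₀ (u₁ * gaugeExp lam)) :
    ∀ m, 1 ≤ m → m < k → ∀ (u₁ : Site d → 𝔹ˣ) (U₁ : Site d → Fin d → 𝔹ˣ) (A : Site d → Fin d → 𝔹),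
      (∀ x, u₁ x ∈ unitaryUnits 𝔹) → (∀ x, x ∉ Ω 0 → u₁ x = 1) → mgauge U₀ u₁ U₁ = U' → Restr129 L m (Λs m) U₀ u₁ →
      IsLandau138W L m η (Ω 0) (Λs m) U₀ U₁ →
      (∀ j, j ≤ m → ∀ b ∈ {b : Site d × Fin d | SideTouches (Ω j) b.1 b.2},
        U₁ b.1 b.2 = cfgExp η A b.1 b.2 ∧ IsSelfAdjoint (A b.1 b.2) ∧ ‖A b.1 b.2‖ ≤ cstar * ((L : ℝ) ^ j * η)⁻¹) →
      ∃ (v : Site d → 𝔹ˣ) (lam : Site d → 𝔹), (∀ x, v x ∈ unitaryUnits 𝔹) ∧ (∀ x, x ∉ Ω 0 → v x = 1) ∧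
        (∀ j, j ≤ m + 1 → ∀ b ∈ {b : Site d × Fin d | SideTouches (Ω j) b.1 b.2}, (v b.1 : 𝔹) = ((gaugeExp lam b.1 : 𝔹ˣ) : 𝔹) ∧
          (v (b.1 + e b.2) : 𝔹) = ((gaugeExp lam (b.1 + e b.2) : 𝔹ˣ) : 𝔹)) ∧
        (∀ j, j ≤ m + 1 → ∀ b ∈ {b : Site d × Fin d | SideTouches (Ω j) b.1 b.2},
          ‖lam b.1‖ ≤ α₄ ∧ ((L : ℝ) ^ j * η) * ‖covDerivFwd η U₀ b.2 lam b.1‖ ≤ α₄) ∧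
        IsLandau138W L (m + 1) η (Ω 0) (Λs (m + 1)) U₀ (mgauge U₀ v⁻¹ U₁) ∧ Restr129 L (m + 1) (Λs (m + 1)) U₀ (u₁ * v) :=
  fun m hm hmk u₁ U₁ A hu₁ hsupp hfix h129 hLan hdat =>
    hP5_step_of_HFP hd2 hη L m hU₀ hs₁ hcs Ω Λs u₁ U₁ A hdat (HFP m hm hmk u₁ U₁ A hu₁ hsupp hfix h129 hLan hdat)

/-- **The socket `hP5base` of `B8Thm4SupportLocal.thm4_exists_all_levels_supp_landau138`, verbatim** (the first step `u₁ = 1`,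
`U₁ = U′`): by (1.66) `|U′ − 1| ≤ a ≤ 1/4` on the bonds of the plaquettes touching `Ω₀`, so `U′ = e^{iηA₀}` there with
`A₀ := (iη)⁻¹ log U′` Hermitian and `|A₀| ≤ 2aη⁻¹ ≤ c⋆η⁻¹` (`B8Thm4TruncationLocal.base_datum`) — the datum of level `0` — and the
plain-currency fixed point `HFP₀` for that datum gives the socket by `hP5_step_of_HFP` at `m = 0`.
[cite: Balaban1985RegularSpaces, Prop. 5 pp.93–94, (1.66) p.88, (1.106)–(1.110) p.94] -/
theorem hP5base_of_HFP (hd2 : 2 ≤ d) {η : ℝ} (hη : 0 < η) (L : ℕ) {U₀ U' : Site d → Fin d → 𝔹ˣ}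
    (hU₀ : ∀ x κ, U₀ x κ ∈ unitaryUnits 𝔹) (hU' : ∀ x κ, U' x κ ∈ unitaryUnits 𝔹) {cstar α₄ a : ℝ} (hs₁ : α₄ ≤ 1 / 84)
    (hcs : cstar ≤ 1 / 12) (ha : a ≤ 1 / 4) (ha2 : 2 * a ≤ cstar) (Ω : ℕ → Set (Site d)) (Λs : ℕ → ℕ → Set (Site d))
    (h66 : ∀ b ∈ {b : Site d × Fin d | SideTouches (Ω 0) b.1 b.2}, ‖((U' b.1 b.2 : 𝔹ˣ) : 𝔹) - 1‖ ≤ a)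
    (HFP₀ : ∀ A : Site d → Fin d → 𝔹,
      (∀ j, j ≤ 0 → ∀ b ∈ {b : Site d × Fin d | SideTouches (Ω j) b.1 b.2},
        U' b.1 b.2 = cfgExp η A b.1 b.2 ∧ IsSelfAdjoint (A b.1 b.2) ∧ ‖A b.1 b.2‖ ≤ cstar * ((L : ℝ) ^ j * η)⁻¹) →
      ∃ lam : Site d → 𝔹, (∀ x, IsSelfAdjoint (lam x)) ∧ (∀ x, x ∉ Ω 0 → lam x = 0) ∧
        (∀ j, j ≤ 1 → ∀ b ∈ {b : Site d × Fin d | SideTouches (Ω j) b.1 b.2},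
          ‖lam b.1‖ ≤ α₄ ∧ ((L : ℝ) ^ j * η) * ‖covDerivFwd η U₀ b.2 lam b.1‖ ≤ α₄) ∧
        (∃ μ : ℕ → Site d → 𝔹, ∀ x ∈ Ω 0,
          covLap η U₀ ((Ω 0).indicator fun y => covDivB η U₀ A y + covLap η U₀ lam y +
            ((conjR (gaugeExp lam y)⁻¹ (covDivB η U₀ A y) - covDivB η U₀ A y) +
              (gAd (covLap η U₀ lam y) (lam y) - covLap η U₀ lam y) + ∑ μ, frakF3 η U₀ lam A y μ)) x =
            QT L 1 (Λs 1) U₀ μ x) ∧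
        Restr129 L 1 (Λs 1) U₀ ((1 : Site d → 𝔹ˣ) * gaugeExp lam)) :
    ∃ (v : Site d → 𝔹ˣ) (lam : Site d → 𝔹), (∀ x, v x ∈ unitaryUnits 𝔹) ∧ (∀ x, x ∉ Ω 0 → v x = 1) ∧
      (∀ j, j ≤ 1 → ∀ b ∈ {b : Site d × Fin d | SideTouches (Ω j) b.1 b.2}, (v b.1 : 𝔹) = ((gaugeExp lam b.1 : 𝔹ˣ) : 𝔹) ∧
        (v (b.1 + e b.2) : 𝔹) = ((gaugeExp lam (b.1 + e b.2) : 𝔹ˣ) : 𝔹)) ∧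
      (∀ j, j ≤ 1 → ∀ b ∈ {b : Site d × Fin d | SideTouches (Ω j) b.1 b.2},
        ‖lam b.1‖ ≤ α₄ ∧ ((L : ℝ) ^ j * η) * ‖covDerivFwd η U₀ b.2 lam b.1‖ ≤ α₄) ∧
      IsLandau138W L 1 η (Ω 0) (Λs 1) U₀ (mgauge U₀ v⁻¹ U') ∧ Restr129 L 1 (Λs 1) U₀ ((1 : Site d → 𝔹ˣ) * v) := by
  set A₀ : Site d → Fin d → 𝔹 := fun y μ => η⁻¹ • ((I⁻¹ : ℂ) • mlog ((U' y μ : 𝔹ˣ) : 𝔹))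
  have hdat : ∀ j, j ≤ 0 → ∀ b ∈ {b : Site d × Fin d | SideTouches (Ω j) b.1 b.2},
      U' b.1 b.2 = cfgExp η A₀ b.1 b.2 ∧ IsSelfAdjoint (A₀ b.1 b.2) ∧ ‖A₀ b.1 b.2‖ ≤ cstar * ((L : ℝ) ^ j * η)⁻¹ := by
    intro j hj b hb
    obtain rfl : j = 0 := Nat.le_zero.mp hj
    obtain ⟨-, hexp, hsa, hn⟩ := base_datum hη U₀ U' hU' ha b.1 b.2 (h66 b hb)
    refine ⟨hexp, hsa, hn.trans ?_⟩
    rw [pow_zero, one_mul]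
    exact mul_le_mul_of_nonneg_right ha2 (inv_nonneg.mpr hη.le)
  exact hP5_step_of_HFP hd2 hη L 0 hU₀ hs₁ hcs Ω Λs 1 U' A₀ hdat (HFP₀ A₀ hdat)

end Assembly

#print axioms hP5_step_of_HFP
#print axioms hP5_of_HFP
#print axioms hP5base_of_HFP

/-! ## §5 (v1.3) THE ORDER RECIPE UNDER RULING (a) (n05-a [WORD-41-ORDER]): the Sect.-E factor is the conjugate `u′ := u₁·v·u₁⁻¹`,
not `v`; then `u′·u₁ = u₁·v` EXACTLY, so (1.29) in the (1.78)-chain's order for `u′` IS (1.29) in the driver's order for `v`, while the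
Landau clause stays at the parameter `λ` of `v` -/

section OrderRecipe

/-- `(u₁·v·u₁⁻¹)·u₁ = u₁·v` (pointwise group algebra): the (1.78)-chain's composite `u′·u₁` for the conjugate Sect.-E factor
`u′ := u₁vu₁⁻¹` is the driver's composite `u₁·v`. [cite: Balaban1985RegularSpaces, p.94 («u = u′u₁»), (1.78) p.90] -/
theorem conj_mul_cancel {G : Type*} [Group G] (u₁ v : Site d → G) : u₁ * v * u₁⁻¹ * u₁ = u₁ * v := by
  funext x
  simp only [Pi.mul_apply, Pi.inv_apply]
  group

omit [NormOneClass 𝔸] in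
/-- Hence (1.29) for `u′·u₁`, `u′ = u₁vu₁⁻¹` (the currency of `B8Eq178Averages.restr129_mul_iff_cond179`), IS (1.29) for the driver's
`u₁·v`. [cite: Balaban1985RegularSpaces, (1.29) p.81, (1.78) p.90, (1.107) p.94] -/
theorem restr129_conj_mul_iff (L k : ℕ) (Λ : ℕ → Set (Site d)) (U₀ : Site d → Fin d → 𝔸ˣ) (u₁ v : Site d → 𝔸ˣ) :
    B8Eq119TwistedAxial.Restr129 L k Λ U₀ (u₁ * v * u₁⁻¹ * u₁) ↔ B8Eq119TwistedAxial.Restr129 L k Λ U₀ (u₁ * v) := by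
  rw [conj_mul_cancel]

omit [NormOneClass 𝔸] in
/-- The conjugate Sect.-E factor of `v = e^{iλ}` is the exponential of the conjugated parameter: `u₁(x)e^{iλ(x)}u₁(x)⁻¹ = e^{i·Ad(u₁(x))λ(x)}`
(`conj_gaugeExp_eq` at `u₁⁻¹`). [cite: Balaban1985RegularSpaces, (1.107) p.94; Balaban1985Averaging, (57) p.27] -/
theorem conj_gaugeExp_eq' (u₁ : Site d → 𝔸ˣ) (lam : Site d → 𝔸) (x : Site d) :
    (u₁ * gaugeExp lam * u₁⁻¹) x = gaugeExp (fun y => conjR (u₁ y) (lam y)) x := by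
  have h := conj_gaugeExp_eq u₁⁻¹ lam x
  simpa only [inv_inv, Pi.inv_apply] using h

omit [NormOneClass 𝔸] in
/-- As functions: `u₁·e^{iλ}·u₁⁻¹ = e^{i·Ad(u₁)λ}`. [cite: Balaban1985RegularSpaces, (1.107) p.94] -/
theorem conj_gaugeExp_funext (u₁ : Site d → 𝔸ˣ) (lam : Site d → 𝔸) :
    u₁ * gaugeExp lam * u₁⁻¹ = gaugeExp (fun y => conjR (u₁ y) (lam y)) :=
  funext (conj_gaugeExp_eq' u₁ lam)

omit [NormOneClass 𝔸] in
/-- **THE RECIPE.** If the (1.78)/Sect.-E chain delivers (1.29) at the `k` levels for the composite `e^{i·Ad(u₁)λ}·u₁` — i.e. its `u′` is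
fed the CONJUGATED parameter `Ad(u₁)λ` — then (1.29) holds for the driver's composite `u₁·e^{iλ}` with the ORIGINAL parameter `λ`, the
one at which the Landau clause ((1.84)–(1.88), `covDivB_logCfg_gaugeFixed`) is read: both clauses of the plain-currency fixed point `HFP`
(`hP5_step_of_HFP`) are then about the same `λ`. [cite: Balaban1985RegularSpaces, (1.29) p.81, (1.106)–(1.107) p.94, Sect. E p.95] -/
theorem restr129_driver_of_sectE (L k : ℕ) (Λ : ℕ → Set (Site d)) (U₀ : Site d → Fin d → 𝔸ˣ) (u₁ : Site d → 𝔸ˣ) (lam : Site d → 𝔸)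
    (h : B8Eq119TwistedAxial.Restr129 L k Λ U₀ (gaugeExp (fun y => conjR (u₁ y) (lam y)) * u₁)) :
    B8Eq119TwistedAxial.Restr129 L k Λ U₀ (u₁ * gaugeExp lam) := by
  rw [← conj_gaugeExp_funext, restr129_conj_mul_iff] at h
  exact h

omit [NormedAlgebra ℂ 𝔸] [CompleteSpace 𝔸] in
/-- The conjugate factor is as close to `1` as `v`: `‖u₁(x)v(x)u₁(x)⁻¹ − 1‖ = ‖v(x) − 1‖` for unitary-type `u₁` — the first regularity
condition ((176) of [3]) of `u′ = u₁vu₁⁻¹` is that of `v`. [cite: Balaban1985RegularSpaces, (1.75) p.89; Balaban1985Averaging, (176) p.45] -/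
theorem norm_conj_sub_one {u₁ : Site d → 𝔸ˣ} (hu : ∀ x, u₁ x ∈ U1 𝔸) (v : Site d → 𝔸ˣ) (x : Site d) :
    ‖(((u₁ * v * u₁⁻¹) x : 𝔸ˣ) : 𝔸) - 1‖ = ‖((v x : 𝔸ˣ) : 𝔸) - 1‖ := by
  have h : (((u₁ * v * u₁⁻¹) x : 𝔸ˣ) : 𝔸) - 1 = conjR (u₁ x) (((v x : 𝔸ˣ) : 𝔸) - 1) := by
    rw [B7Eq78Linearization.conjR_sub, B7Eq78Linearization.conjR_one, B7Eq78Linearization.conjR_apply]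
    simp only [Pi.mul_apply, Pi.inv_apply, Units.val_mul]
  rw [h, B8Ineq132.norm_conjR (hu x)]

omit [NormOneClass 𝔸] [CompleteSpace 𝔸] in
/-- The parameter side: `D^η_{U₀,κ}(Ad(u₁)λ)(x) = Ad(u₁(x))·(D^η_{U₀^{u₁⁻¹},κ}λ)(x)` (`covDerivFwd_conj_param` at `u₁⁻¹`) — the second
regularity condition of the conjugate factor is (1.108) for `λ` read at the background `U₀^{u₁⁻¹}`, comparable to `U₀` at the (1.73) price
(`norm_covDerivFwd_gaugeAct_sub_le`). [cite: Balaban1985RegularSpaces, (1.73) p.89, (1.108) p.94, (1.11) p.77] -/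
theorem covDerivFwd_conj_param' (η : ℝ) (U₀ : Site d → Fin d → 𝔸ˣ) (u₁ : Site d → 𝔸ˣ) (lam : Site d → 𝔸) (κ : Fin d) (x : Site d) :
    covDerivFwd η U₀ κ (fun y => conjR (u₁ y) (lam y)) x = conjR (u₁ x) (covDerivFwd η (gaugeAct u₁⁻¹ U₀) κ lam x) := by
  have h := covDerivFwd_conj_param η U₀ u₁⁻¹ lam κ x
  simpa only [inv_inv, Pi.inv_apply] using h

end OrderRecipe

#print axioms restr129_driver_of_sectE

/-! ## §6 (v1.4) THE «WHY Z» ALGEBRA (n19-b [SIGNATURE-41b]): the right-hand side of the D*-identity at `λ′ = λ − H′D′λ` is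
`W + (Δλ + V(Δλ))`, `V f = g(i ad_{λ′})f − f`; under the Neumann equation `Z + V(RZ) = W` and `Δλ = −RZ` it is `Z − RZ` on `Ω₀` —
letter-free: `Z`, `RZ`, `H′D′λ` enter as plain site functions -/

section WhyZ

omit [NormOneClass 𝔸] [CompleteSpace 𝔸] in
/-- The covariant Laplacian is additive: `Δ^η_{U₀}(f − g) = Δ^η_{U₀}f − Δ^η_{U₀}g` ((1.1): `D`, `D*` are linear).
[cite: Balaban1985RegularSpaces, (1.1) p.76] -/
theorem covLap_sub (η : ℝ) (U₀ : Site d → Fin d → 𝔸ˣ) (f g : Site d → 𝔸) (x : Site d) :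
    covLap η U₀ (f - g) x = covLap η U₀ f x - covLap η U₀ g x := by
  show (∑ μ, covDeriv η U₀ μ (covDerivFwd η U₀ μ (f - g)) x) =
    (∑ μ, covDeriv η U₀ μ (covDerivFwd η U₀ μ f) x) - ∑ μ, covDeriv η U₀ μ (covDerivFwd η U₀ μ g) x
  rw [← Finset.sum_sub_distrib]
  refine Finset.sum_congr rfl fun μ _ => ?_
  simp only [covDeriv, covDerivFwd, Pi.sub_apply, B7Eq78Linearization.conjR_sub, B7Eq78Linearization.conjR_smul_real, smul_sub]
  abel

omit [NormOneClass 𝔸] in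
/-- `g(i ad_Y)` is additive in its argument (for `|Y| ≤ 1/12`): `g(i ad_Y)(X₁ − X₂) = g(i ad_Y)X₁ − g(i ad_Y)X₂`.
[cite: Balaban1985RegularSpaces, (1.82) p.91] -/
theorem gAd_sub (X₁ X₂ : 𝔸) {Y : 𝔸} (hY : ‖Y‖ ≤ 1 / 12) : gAd (X₁ - X₂) Y = gAd X₁ Y - gAd X₂ Y := by
  rw [sub_eq_add_neg, B8Eq188Proof.gAd_add _ _ hY, B8Eq188Proof.gAd_neg _ hY, ← sub_eq_add_neg]

omit [NormOneClass 𝔸] in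
/-- **The right-hand side of the D*-identity at `λ′ = λ − H_c`** (`H_c = H′D′λ`, (1.113)): with `V f := g(i ad_{λ′})f − f` and
`W := R(e^{−iλ′})D*A − g(i ad_{λ′})ΔH_c + Σ_μ 𝔉₃` (n19-b's `Vop`, `Wsrc`),
`D*A + Δλ′ + 𝔑(λ′) = W + (Δλ + V(Δλ))` — pure algebra (`g(i ad)` additive, `Δ` additive).
[cite: Balaban1985RegularSpaces, (1.88) p.91, (1.94)–(1.96) p.92, (1.113) p.95] -/
theorem dstar_rhs_eq_W_add {η : ℝ} (U₀ : Site d → Fin d → 𝔸ˣ) (A : Site d → Fin d → 𝔸) {lam lam' Hc : Site d → 𝔸}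
    (hdef : lam' = lam - Hc) {y : Site d} (hl : ‖lam' y‖ ≤ 1 / 12) :
    covDivB η U₀ A y + covLap η U₀ lam' y +
        ((conjR (gaugeExp lam' y)⁻¹ (covDivB η U₀ A y) - covDivB η U₀ A y) +
          (gAd (covLap η U₀ lam' y) (lam' y) - covLap η U₀ lam' y) + ∑ μ, frakF3 η U₀ lam' A y μ) =
      (conjR (gaugeExp lam' y)⁻¹ (covDivB η U₀ A y) - gAd (covLap η U₀ Hc y) (lam' y) + ∑ μ, frakF3 η U₀ lam' A y μ) +
        (covLap η U₀ lam y + (gAd (covLap η U₀ lam y) (lam' y) - covLap η U₀ lam y)) := by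
  have hL : covLap η U₀ lam' y = covLap η U₀ lam y - covLap η U₀ Hc y := by rw [hdef, covLap_sub]
  rw [hL, gAd_sub _ _ hl]
  abel

omit [NormOneClass 𝔸] in
/-- **«WHY Z».**  If `Z` solves the Neumann equation `Z + V(RZ) = W` at `y` ((1.96): `Z = (I + VR)⁻¹W`) and `Δλ(y) = −(RZ)(y)`
(the fixed point `λ = G′R(−Z)`, (1.100)/(1.106)), then the right-hand side of the D*-identity at `λ′ = λ − H_c` equals `Z(y) − (RZ)(y)` —
so «R D*[(1/iη) log U₁^{u′⁻¹}] = R Z − R²Z = 0» is one projection law away.  `Z`, `RZ`, `H_c` are plain site functions here.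
[cite: Balaban1985RegularSpaces, (1.94)–(1.96) p.92, (1.100) p.93, (1.106) p.94] -/
theorem dstar_rhs_eq_Z_sub_RZ {η : ℝ} (U₀ : Site d → Fin d → 𝔸ˣ) (A : Site d → Fin d → 𝔸) {lam lam' Hc Z RZ : Site d → 𝔸}
    (hdef : lam' = lam - Hc) {y : Site d} (hl : ‖lam' y‖ ≤ 1 / 12)
    (hN : Z y + (gAd (RZ y) (lam' y) - RZ y) =
      conjR (gaugeExp lam' y)⁻¹ (covDivB η U₀ A y) - gAd (covLap η U₀ Hc y) (lam' y) + ∑ μ, frakF3 η U₀ lam' A y μ)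
    (hΔ : covLap η U₀ lam y = -RZ y) :
    covDivB η U₀ A y + covLap η U₀ lam' y +
        ((conjR (gaugeExp lam' y)⁻¹ (covDivB η U₀ A y) - covDivB η U₀ A y) +
          (gAd (covLap η U₀ lam' y) (lam' y) - covLap η U₀ lam' y) + ∑ μ, frakF3 η U₀ lam' A y μ) = Z y - RZ y := by
  rw [dstar_rhs_eq_W_add U₀ A hdef hl, ← hN, hΔ, B8Eq188Proof.gAd_neg _ hl]
  abel

omit [NormOneClass 𝔸] in
/-- The multiplier clause of the plain-currency fixed point only reads its source ON `Ω₀`: two sources that agree on `Ω₀` give the same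
clause (the indicator `↾Ω₀` sits inside `Δ^η_{U₀}`, as in `IsLandau138W`). [cite: Balaban1985RegularSpaces, (1.38) p.82, (1.95) p.92] -/
theorem multiplier_congr_on {η : ℝ} (L m : ℕ) (Ω₀ : Set (Site d)) (Λs : ℕ → Set (Site d)) (U₀ : Site d → Fin d → 𝔸ˣ)
    {F G : Site d → 𝔸} (h : ∀ y ∈ Ω₀, F y = G y) :
    (∃ μ : ℕ → Site d → 𝔸, ∀ x ∈ Ω₀, covLap η U₀ (Ω₀.indicator F) x = QT L m Λs U₀ μ x) ↔
      ∃ μ : ℕ → Site d → 𝔸, ∀ x ∈ Ω₀, covLap η U₀ (Ω₀.indicator G) x = QT L m Λs U₀ μ x := by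
  rw [Set.indicator_congr h]

omit [NormOneClass 𝔸] in
/-- **Corollary (the multiplier clause of `HFP` after «WHY Z»).**  Under the Neumann equation and `Δλ = −RZ` on `Ω₀` (and
`|λ′| ≤ 1/12` there), the multiplier clause of `hP5_step_of_HFP` for `λ′` IS the statement `∃ μ, Δ^η_{U₀}↾Ω₀(Z − RZ) = Q′ᵀμ` on `Ω₀` —
which the projection law «R(Z − RZ) = 0 ⟹ multiplier» (`B8Eq138Multiplier.proj325_apply_eq_zero_iff_exists` at the concrete letters)
discharges. [cite: Balaban1985RegularSpaces, (1.95)–(1.96) p.92, (1.106) p.94, (1.38) p.82] -/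
theorem multiplier_iff_of_whyZ {η : ℝ} (L m : ℕ) (Ω₀ : Set (Site d)) (Λs : ℕ → Set (Site d)) (U₀ : Site d → Fin d → 𝔸ˣ)
    (A : Site d → Fin d → 𝔸) {lam lam' Hc Z RZ : Site d → 𝔸} (hdef : lam' = lam - Hc) (hl : ∀ y ∈ Ω₀, ‖lam' y‖ ≤ 1 / 12)
    (hN : ∀ y ∈ Ω₀, Z y + (gAd (RZ y) (lam' y) - RZ y) =
      conjR (gaugeExp lam' y)⁻¹ (covDivB η U₀ A y) - gAd (covLap η U₀ Hc y) (lam' y) + ∑ μ, frakF3 η U₀ lam' A y μ)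
    (hΔ : ∀ y ∈ Ω₀, covLap η U₀ lam y = -RZ y) :
    (∃ μ : ℕ → Site d → 𝔸, ∀ x ∈ Ω₀,
      covLap η U₀ (Ω₀.indicator fun y => covDivB η U₀ A y + covLap η U₀ lam' y +
        ((conjR (gaugeExp lam' y)⁻¹ (covDivB η U₀ A y) - covDivB η U₀ A y) +
          (gAd (covLap η U₀ lam' y) (lam' y) - covLap η U₀ lam' y) + ∑ μ, frakF3 η U₀ lam' A y μ)) x = QT L m Λs U₀ μ x) ↔
      ∃ μ : ℕ → Site d → 𝔸, ∀ x ∈ Ω₀, covLap η U₀ (Ω₀.indicator (Z - RZ)) x = QT L m Λs U₀ μ x :=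
  multiplier_congr_on L m Ω₀ Λs U₀ fun y hy => by
    rw [Pi.sub_apply]
    exact dstar_rhs_eq_Z_sub_RZ U₀ A hdef (hl y hy) (hN y hy) (hΔ y hy)

end WhyZ

#print axioms multiplier_iff_of_whyZ

end Literature.MathematicalPhysics.QuantumFieldTheory.Balaban1983to89.B8Prop5KLevelLetters

end
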